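import Mathlib
import HarnessLib
import Summits.NavierStokesRegularity.NavierStokesRegularity.Theorems.TypeIQuarterGateScarEnvelopeTypeIForcedTsaiAlgCertF

/-!
# ARM B lane E-exact, Type-I-tail class — rows with the EXACT WEIGHT `(1+ρ)⁵` (`AlgRowG`, LANEX-ALG v3)

The v1/v2 checkers (`…ForcedTsaiAlgCert`, `…AlgCertF`) bound the residual currency
`∫ (1+ρ)⁵ |g|²` through an EVEN majorant `m = 1 + 10t + 5t² + 5B₁ + 10B₃ + B₅ ≥ (1+ρ)⁵`
(`B_j = (r_j ρ^{j−1} + ρ^{j+1}/r_j)/2 ≥ ρ^j`, AM-GM with row-supplied radii), because their moment table only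
knows `∫ y^a v^h dy`.  The AM-GM step costs 6–7 % of `δ²` on every landed Type-I-tail witness.  This module
removes it: `(1+ρ)⁵ = (1 + 10t + 5t²) + ρ·(5 + 10t + t²)` (`t = ρ² = |y|²`), the even part is integrated by
the landed table, and the odd part by the EXACT RADIAL MOMENT
`∫_{ℝ³} y^a t^k ρ v^h dy = S_a · ½ τ^{m+1} Γ((m+1)/2) Γ((h−m−1)/2) / Γ(h/2)`, `m = |a| + 2k + 3`,
`S_a = ∫_{S²} θ^a dσ = 2 Πᵢ Γ((aᵢ+1)/2) / Γ((|a|+3)/2)` (all `aᵢ` even; else `0`), absolutely convergent iff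
`h > |a| + 2k + 4`; for even `|a|` every Gamma ratio is rational up to ONE factor `π`, so odd moments lie in
`ℚ·π` (`Mono5.momentOddQ`).  Row of record `AlgRowG = {τ, Ψ, floor, M, δ}` — the v2 row WITHOUT radii;
`AlgRowG.checkG` = floor certificate + `M² ≤ lo(∫ P(W)|ω|²)` + `hi(∫ (1+ρ)⁵|gNF|²) ≤ δ²` (exact `ℚ·{π,π²}`
arithmetic, termwise-signed enclosures of `π`).  Soundness (`AlgRowG.sound : checkG = true → ForcedTsaiModulusLE M δ`,
polar factorisation of `ℝ³` moments + Gamma subordination of the radial Beta integral) is in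
`…ForcedTsaiAlgSoundG`; until it lands a passing row is a kernel-REPLAYED exact computation.
Mirror: `pub-ns-dss/wall-extremal/arm-B/alg/v3/algcertG.py`.
Effect (exact arithmetic on the landed v2 witnesses, same floor certificate): δ/M 15.87 → 15.37 @¼,
18.25 → 17.65 @4 (ℓ = 1), 19.27 → 18.58 @16 (multi-ℓ with swirl).
HONEST FRAMING: certificate format; UPPER bounds on the forced-Tsai modulus only («near-profiles this good
exist»); excludes nothing; nothing about NS regularity; 23843 / H3 OPEN.
-/

set_option linter.dupNamespace false

namespace Summit.NavierStokesRegularity.NavierStokesRegularity.Cruxes.ScarEnvelopeTypeI.ForcedTsai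

/-! ## Exact odd radial moments `∫ y^a t^k ρ v^h dy ∈ ℚ·π` -/

namespace Mono5

/-- Absolute convergence of `∫ |c y^a| t^k ρ v^h` over `ℝ³`: `h > |a| + 2k + 4`. -/
def convOdd (m : Mono5) : Bool := decide (m.e1 + m.e2 + m.e3 + 2 * m.et + 4 < m.eh)

/-- The rational factor of `∫ c y^a t^k ρ v^h dy` (`× π`):
`c · 2Πᵢ ghalf(aᵢ+1)/ghalf(|a|+3) · τ^{m+1}/2 · ghalf(m+1) · ghalf(h−m−1)/ghalf(h)`, `m = |a|+2k+3`
(the sphere moment `S_a/π` times the radial Beta integral), and `0` if some `aᵢ` is odd. -/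
def momentOddQ (τ : ℚ) (m : Mono5) : ℚ :=
  if m.e1 % 2 = 1 ∨ m.e2 % 2 = 1 ∨ m.e3 % 2 = 1 then 0 else
    m.c * (2 * ghalf (m.e1 + 1) * ghalf (m.e2 + 1) * ghalf (m.e3 + 1) / ghalf (m.e1 + m.e2 + m.e3 + 3)) *
      (τ ^ (m.e1 + m.e2 + m.e3 + 2 * m.et + 4) / 2 * ghalf (m.e1 + m.e2 + m.e3 + 2 * m.et + 4) *
        ghalf (m.eh - (m.e1 + m.e2 + m.e3 + 2 * m.et + 4)) / ghalf m.eh)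

end Mono5

/-- `∫ ρ · P dy = c·π` as the rational `c`, or `none` if some monomial of `P` diverges against `ρ`. -/
def Poly5.integrateOdd (τ : ℚ) (P : Poly5) : Option ℚ :=
  if P.all Mono5.convOdd then some ((P.map (Mono5.momentOddQ τ)).sum) else none

/-! ## The exact weight `(1+ρ)⁵ = (1 + 10t + 5t²) + ρ·(5 + 10t + t²)` -/

/-- Even part of `(1+ρ)⁵`: `1 + 10t + 5t²`. -/
def weightEven : Poly5 := [tMono 0 1, tMono 1 10, tMono 2 5]

/-- Odd part of `(1+ρ)⁵` divided by `ρ`: `5 + 10t + t²`. -/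
def weightOdd : Poly5 := [tMono 0 5, tMono 1 10, tMono 2 1]

/-! ## Rows and the check -/

/-- A Type-I-tail witness row with the certified polynomial floor and the EXACT residual weight (v3):
as `AlgRowF` without the AM-GM radii. -/
structure AlgRowG where
  /-- kernel scale `τ` -/ tau : ℚ
  /-- the three components of the symbolic vector potential `Ψ` -/ psi : Fin 3 → Poly5
  /-- the certified polynomial level floor -/ floor : FloorCert
  /-- claimed level floor -/ M : ℚ
  /-- claimed residual ceiling -/ δ : ℚ

namespace AlgRowG

/-- The underlying v1 row (floor parameters and radii are dummies, unused by the v3 check). -/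
def toRow (r : AlgRowG) : AlgRow := ⟨r.tau, r.psi, 0, 0, 1, 1, 1, r.M, r.δ⟩

/-- The underlying v2 row (radii are dummies; only its level side `lev2F` is used). -/
def toRowF (r : AlgRowG) : AlgRowF := ⟨r.tau, r.psi, r.floor, 1, 1, 1, r.M, r.δ⟩

/-- `|gNF|²` as a 5-polynomial (sum of the three squared components of the normal-form residual). -/
def g2Poly (r : AlgRowG) : Poly5 :=
  Poly5.add (Poly5.add (Poly5.nmul (r.toRow.gNF 0) (r.toRow.gNF 0)) (Poly5.nmul (r.toRow.gNF 1) (r.toRow.gNF 1)))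
    (Poly5.nmul (r.toRow.gNF 2) (r.toRow.gNF 2))

/-- Even residual integrand `(1 + 10t + 5t²)·|gNF|²`. -/
def resPolyE (r : AlgRowG) : Poly5 := Poly5.nmul weightEven r.g2Poly

/-- Odd residual integrand (without its factor `ρ`): `(5 + 10t + t²)·|gNF|²`. -/
def resPolyO (r : AlgRowG) : Poly5 := Poly5.nmul weightOdd r.g2Poly

/-- `∫ (1+10t+5t²)|gNF|²` as `(c₁, c₂)` (or `none`). -/
def res2E (r : AlgRowG) : Option (ℚ × ℚ) := Poly5.integrate r.tau r.resPolyE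

/-- `∫ ρ(5+10t+t²)|gNF|² = c·π` as `c` (or `none`). -/
def res2O (r : AlgRowG) : Option ℚ := Poly5.integrateOdd r.tau r.resPolyO

/-- **The total Boolean check of a v3 row** (exact rational arithmetic): `0 < τ`, `0 ≤ M, δ`, the floor
certificate, `M² ≤ lo(∫ P(W)|ω|²)`, `hi(∫ (1+ρ)⁵ |gNF|²) ≤ δ²`. -/
def checkG (r : AlgRowG) : Bool :=
  decide (0 < r.tau) && decide (0 ≤ r.M) && decide (0 ≤ r.δ) && r.floor.check r.tau &&
    (match r.toRowF.lev2F, r.res2E, r.res2O with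
      | some L, some R, some o => decide (r.M * r.M ≤ encLo L) && decide (encHi (R.1 + o, R.2) ≤ r.δ * r.δ)
      | _, _, _ => false)

end AlgRowG

/-- A table of v3 rows. -/
abbrev AlgTableG := List AlgRowG

/-- Every row passes. -/
def AlgTableG.checkG (T : AlgTableG) : Bool := T.all AlgRowG.checkG

/-! ## Kernel self-test (a tiny non-witness row: exercises the pipeline, both moment tables and the enclosures) -/

/-- Self-test row: `Ψ = 10⁻³·(−y₂, y₁, 0)·v⁹` (`τ = 3`), trivial floor `P = 0`, claims `M = 0`, `δ = 1`. -/
def algRowGSelfTest : AlgRowG where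
  tau := 3
  psi := ![[⟨0, 1, 0, 0, 9, -(1 / 1000)⟩], [⟨1, 0, 0, 0, 9, 1 / 1000⟩], []]
  floor := ⟨[0], [0, 9 / 109], [9 / 109, 1]⟩
  M := 0
  δ := 1

/-- The self-test row passes `checkG` (kernel replay by `decide +kernel` would be slow; `native_decide`). -/
example : algRowGSelfTest.checkG = true := by native_decide

end Summit.NavierStokesRegularity.NavierStokesRegularity.Cruxes.ScarEnvelopeTypeI.ForcedTsai
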